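import Mathlib
import Summits.Ventures.PercRepro.TriangleCapPairWitness
import Summits.Ventures.PercRepro.TriangleCapVertexBandSharp

/-!
# PercRepro — THE PATH WITNESS: THE MIDDLE REGIME `t + 1 ≤ ℓ ≤ 2 t` OF THE BAND BOUND ON `n` VERTICES IS ATTAINED
(p3, gen 51; part 246)

With `ℓ = n − 1 − (s − t)` non-neighbours of the star centre the sharp bound of part 243 at `q = 1` reads
`j ≤ C(t, 2) + ℓ − t` (`t + 1 ≤ ℓ ≤ 2 t`).  It is attained by a pair witness whose `t` off-pairs form ONE alternating
path of `k = 2 t − ℓ + 1` edges (`pathL k i = 1 + (i + 1) / 2`, `pathR b k i = b + i / 2` for `i < k`: left vertices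
`1, 2, 2, 3, 3, …`, right vertices `b, b, b + 1, b + 1, …`) plus `ℓ − t − 1` single edges on fresh vertices; every
right end is a non-leaf (`attach = 0`), and the collisions are the `k − 1` consecutive pairs of the path
(`coll_le_two_mul_consecutive`: a left-end function whose collisions are consecutive indices has at most `2 ×`
the number of consecutive collisions; `card_filter_mod_eq` counts them), so `P ≤ 2 (2 t − ℓ)` and with the sharp
bound `2 j + 2 t = t (t − 1) + 2 ℓ` (`middle_band_attained`).  Axioms: standard.
-/

namespace PercRepro

namespace TriangleCap

namespace C047

open Finset

/-- **COLLISIONS ON CONSECUTIVE INDICES ONLY:** if `lf i = lf i'` (`i ≠ i' < t`) forces `|i − i'| = 1`, then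
`coll t lf ≤ 2 · #{i < t − 1 : lf i = lf (i + 1)}`. -/
theorem coll_le_two_mul_consecutive (t : ℕ) (lf : ℕ → ℕ)
    (hcons : ∀ i i', i < t → i' < t → lf i = lf i' → i ≠ i' → i + 1 = i' ∨ i' + 1 = i) :
    coll t lf ≤ 2 * ((range (t - 1)).filter (fun i => lf i = lf (i + 1))).card := by
  unfold coll
  apply card_le_mul_card_image_of_maps_to (f := fun p : ℕ × ℕ => min p.1 p.2)
  · intro p hp
    rw [mem_filter, mem_offDiag, mem_range, mem_range] at hp
    obtain ⟨⟨h1, h2, h3⟩, h4⟩ := hp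
    rw [mem_filter, mem_range]
    rcases hcons p.1 p.2 h1 h2 h4 h3 with h | h
    · rw [min_eq_left (by omega)]
      exact ⟨by omega, by rw [h]; exact h4⟩
    · rw [min_eq_right (by omega)]
      exact ⟨by omega, by rw [h]; exact h4.symm⟩
  · intro m _
    refine le_trans (card_le_card (show ((range t).offDiag.filter (fun p : ℕ × ℕ => lf p.1 = lf p.2)).filter
      (fun p => min p.1 p.2 = m) ⊆ {(m, m + 1), (m + 1, m)} from ?_)) card_le_two
    intro p hp
    rw [mem_filter, mem_filter, mem_offDiag, mem_range, mem_range] at hp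
    obtain ⟨⟨⟨h1, h2, h3⟩, h4⟩, h5⟩ := hp
    rw [mem_insert, mem_singleton, Prod.ext_iff, Prod.ext_iff]
    rcases hcons p.1 p.2 h1 h2 h4 h3 with h | h
    · rw [min_eq_left (by omega)] at h5
      left; omega
    · rw [min_eq_right (by omega)] at h5
      right; omega

/-- The left ends of the path witness: the path `1, 2, 2, 3, 3, …` on `i < k`, then fresh vertices. -/
def pathL (k i : ℕ) : ℕ := if i < k then 1 + (i + 1) / 2 else (k + 2) / 2 + 1 + (i - k)

/-- The right ends of the path witness: the path `b, b, b + 1, b + 1, …` on `i < k`, then fresh vertices. -/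
def pathR (b k i : ℕ) : ℕ := if i < k then b + i / 2 else b + (k + 1) / 2 + (i - k)

/-- The collisions of the path's left ends are consecutive. -/
theorem pathL_cons (k t i i' : ℕ) (_hi : i < t) (_hi' : i' < t) (h : pathL k i = pathL k i') (hne : i ≠ i') :
    i + 1 = i' ∨ i' + 1 = i := by
  unfold pathL at h
  split_ifs at h <;> omega

/-- The collisions of the path's right ends are consecutive. -/
theorem pathR_cons (b k t i i' : ℕ) (_hi : i < t) (_hi' : i' < t) (h : pathR b k i = pathR b k i') (hne : i ≠ i') :
    i + 1 = i' ∨ i' + 1 = i := by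
  unfold pathR at h
  split_ifs at h <;> omega

/-- The consecutive left collisions are the odd indices below `k − 1`. -/
theorem filter_pathL_consecutive (k t : ℕ) (hk : k ≤ t) :
    (range (t - 1)).filter (fun i => pathL k i = pathL k (i + 1)) = (range (k - 1)).filter (fun i => i % 2 = 1) := by
  ext i
  simp only [mem_filter, mem_range]
  unfold pathL
  constructor
  · rintro ⟨hi, h⟩
    split_ifs at h <;> omega
  · rintro ⟨hi, h⟩
    refine ⟨by omega, ?_⟩
    rw [if_pos (by omega), if_pos (by omega)]
    omega

/-- The consecutive right collisions are the even indices below `k − 1`. -/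
theorem filter_pathR_consecutive (b k t : ℕ) (hk : k ≤ t) :
    (range (t - 1)).filter (fun i => pathR b k i = pathR b k (i + 1)) =
      (range (k - 1)).filter (fun i => i % 2 = 0) := by
  ext i
  simp only [mem_filter, mem_range]
  unfold pathR
  constructor
  · rintro ⟨hi, h⟩
    split_ifs at h <;> omega
  · rintro ⟨hi, h⟩
    refine ⟨by omega, ?_⟩
    rw [if_pos (by omega), if_pos (by omega)]
    omega

/-- **THE PATH HAS `k − 1` COLLISIONS** (ordered: `2 (k − 1)`): `coll t (pathL k) + coll t (pathR b k) ≤ 2 (k − 1)`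
for `1 ≤ k ≤ t`. -/
theorem coll_path_le (b k t : ℕ) (_hk1 : 1 ≤ k) (hk : k ≤ t) :
    coll t (pathL k) + coll t (pathR b k) ≤ 2 * (k - 1) := by
  have h1 := coll_le_two_mul_consecutive t (pathL k) (fun i i' hi hi' h hne => pathL_cons k t i i' hi hi' h hne)
  have h2 := coll_le_two_mul_consecutive t (pathR b k) (fun i i' hi hi' h hne => pathR_cons b k t i i' hi hi' h hne)
  rw [filter_pathL_consecutive k t hk, card_filter_mod_eq 2 (by norm_num) 1 (by norm_num)] at h1
  rw [filter_pathR_consecutive b k t hk, card_filter_mod_eq 2 (by norm_num) 0 (by norm_num)] at h2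
  have hmod := Nat.mod_lt (k - 1) (by norm_num : 0 < 2)
  have hdiv := Nat.div_add_mod (k - 1) 2
  split_ifs at h1 h2 <;> omega

/-- **THE MIDDLE REGIME IS ATTAINED** (`1 ≤ t`, `t + 1 ≤ ℓ ≤ 2 t`, `2 t ≤ s`): a triangle-free graph on
`ℓ + 1 + (s − t)` vertices with `s` edges, a vertex of degree `s − t`, and `Σ d² + 2 t (s − t − 1) + 2 j = s (s + 1)`
with `2 j + 2 t = t (t − 1) + 2 ℓ`, i.e. `j = C(t, 2) + ℓ − t`. -/
theorem middle_band_attained (ℓ s t : ℕ) (ht : 1 ≤ t) (hl1 : t + 1 ≤ ℓ) (hl2 : ℓ ≤ 2 * t) (hs : 2 * t ≤ s) :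
    ∃ (H : SimpleGraph (Fin (ℓ + 1 + (s - t)))) (_ : DecidableRel H.Adj) (j : ℕ), H.CliqueFree 3 ∧
      H.edgeFinset.card = s ∧ (∃ w, deg H w + t = s) ∧
      ∑ v, deg H v * deg H v + 2 * (t * (s - t - 1)) + 2 * j = s * (s + 1) ∧
      2 * j + 2 * t = t * (t - 1) + 2 * ℓ := by
  -- the parameters: `k` path edges, `p` single edges, `a − 1` left and `c` right non-leaf vertices
  obtain ⟨k, hk⟩ : ∃ k, k = 2 * t - ℓ + 1 := ⟨_, rfl⟩
  obtain ⟨p, hp⟩ : ∃ p, p = ℓ - t - 1 := ⟨_, rfl⟩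
  have hkt : k + p = t := by omega
  have hk1 : 1 ≤ k := by omega
  obtain ⟨a, ha⟩ : ∃ a, a = (k + 2) / 2 + p + 1 := ⟨_, rfl⟩
  obtain ⟨c, hc⟩ : ∃ c, c = (k + 1) / 2 + p := ⟨_, rfl⟩
  have hac : a + c = ℓ + 1 := by omega
  set n := ℓ + 1 + (s - t) with hn
  have hn0 : 0 < n := by omega
  obtain ⟨b, hb⟩ : ∃ b, b = a + (s - t) := ⟨_, rfl⟩
  have hbn : b + c = n := by omega
  have hg : GoodEnds n a t (pathL k) (pathR b k) := by
    refine ⟨fun i hi => ?_, fun i hi => ?_, fun i i' hi hi' h1 h2 => ?_⟩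
    · unfold pathL
      split_ifs <;> omega
    · unfold pathR
      split_ifs <;> omega
    · unfold pathL at h1
      unfold pathR at h2
      split_ifs at h1 h2 <;> omega
  have ha1 : 1 ≤ a := by omega
  have han : a + (s - t) ≤ n := by omega
  have hval := genWitness_missing_value n a s t hn0 (pathL k) (pathR b k) hg ha1 ht (by omega) han
  have hatt : ((range t).filter (fun i => pathR b k i < a + (s - t))).card = 0 := by
    rw [card_eq_zero, filter_eq_empty_iff]
    intro i _
    unfold pathR
    split_ifs <;> omega
  rw [hatt, Nat.sub_zero] at hval
  have hP := coll_path_le b k t hk1 (by omega)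
  have hfree : (missingGraph (genWitness n a s t hn0 (pathL k) (pathR b k)) (leftPart n a)).CliqueFree 3 :=
    cliqueFree_of_bipSub _ _ (bipSub_missingGraph _ _)
  have hE := card_edges_missingGraph_genWitness n a s t hn0 (pathL k) (pathR b k) hg ha1 (by omega) han
  have hdeg := deg_missingGraph_genWitness_zero n a s t hn0 (pathL k) (pathR b k) hg ha1 han
  -- the sharp bound pins the collision count from the other side
  have hoff : (offEdges (missingGraph (genWitness n a s t hn0 (pathL k) (pathR b k)) (leftPart n a))
      (fin' n hn0 0)).card = t := by
    rw [offEdges_missingGraph_genWitness n a s t hn0 (pathL k) (pathR b k) hg (by omega),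
      card_genPairs n a t hn0 (pathL k) (pathR b k) hg (by omega)]
  have hPle : coll t (pathL k) + coll t (pathR b k) ≤ t * (t - 1) := by
    have h1 := offAdjPairs_add_le (missingGraph (genWitness n a s t hn0 (pathL k) (pathR b k)) (leftPart n a))
      (fin' n hn0 0)
    rw [hoff, offAdjPairs_genWitness n a s t hn0 (pathL k) (pathR b k) hg (by omega)] at h1
    have e : t * t = t * (t - 1) + t := by
      obtain ⟨t', rfl⟩ : ∃ t', t = t' + 1 := ⟨t - 1, by omega⟩
      rw [Nat.add_sub_cancel]
      ring
    omega
  obtain ⟨j, hj⟩ : ∃ j, j = t + (t * (t - 1) - (coll t (pathL k) + coll t (pathR b k))) / 2 := ⟨_, rfl⟩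
  have hPeven : Even (coll t (pathL k) + coll t (pathR b k)) := (coll_even _ _).add (coll_even _ _)
  obtain ⟨u, hu⟩ := hPeven
  obtain ⟨c', hc'⟩ := Nat.even_mul_pred_self t
  have hj2 : 2 * j = 2 * t + (t * (t - 1) - (coll t (pathL k) + coll t (pathR b k))) := by omega
  have hS : ∑ v, deg (missingGraph (genWitness n a s t hn0 (pathL k) (pathR b k)) (leftPart n a)) v *
      deg (missingGraph (genWitness n a s t hn0 (pathL k) (pathR b k)) (leftPart n a)) v +
      2 * (t * (s - t - 1)) + 2 * j = s * (s + 1) := by omega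
  have hsharp := band_bound_vertices_sharp _ hfree s t j hE (fin' n hn0 0) (by omega) hoff hS 1 le_rfl
  rw [Fintype.card_fin] at hsharp
  refine ⟨_, inferInstance, j, hfree, hE, ⟨fin' n hn0 0, by omega⟩, hS, ?_⟩
  have hn' : n - 1 - (s - t) = ℓ := by omega
  rw [hn'] at hsharp
  omega

end C047

end TriangleCap

end PercRepro
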